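import Summits.BirchSwinnertonDyer.BirchSwinnertonDyer.Theorems.PrintX10bStubAExactAtPOfClauses
import Literature.NumberTheory.EllipticCurves.ZpExtensionEisensteinDVRSettingH4ExactRepLeftProofs
import Literature.NumberTheory.EllipticCurves.ZpExtensionEisensteinTransportedCoreScalarProofs
import HarnessLib

/-!
# STUB A of the shared μ-item — the (EXACT-REP) half of `Stmt.exactAtP` on the frames: `exactRepAtP_holds` (x9-p1-w4 g9)

Helper toward the registered stub `stub_exactAtP : Stmt.exactAtP` of skeleton v8 of the shared deciding μ-item
(`MuInequalityCoherentPairOfPrintCG`, stmt-BirchSwinnertonDyer-23428).  D1's letter `HeegnerMuPartH4AtS.Stmt.exactRepAtP`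
(LEAD `bsd-line-x10b-p1` g9, `Theorems/PrintX10bStubAExactAtPOfClauses.lean`) asks, under the binders of `Stmt.exactAtP` verbatim and
for all `m ≥ m₇`, at every `(k, v ∈ S, p ∈ v)`, for the conclusions of the generic (EXACT-REP)
`Tower.exists_sub_pow_smul_forall_pairing_eq_zero` on the `D`-indexed local Eisenstein towers, both orientations.  This file is the
FRAME TERM `exactRepAtP_holds : Stmt.exactRepAtP` (threshold `m₇ := 0`): conjunct 1 (`Y`-side) := x9-p1-w2 g8's
`WeierstrassCurve.eisensteinTower_exists_sub_pow_smul_forall_localCup_eq_zero` (`…H4ExactRepProofs`, p675241) at the strict ordinary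
cores `C_j := ordinaryCore v` (their `A_{m,j+1}`-stability = `OrdinaryFiltration.scalarMapH1_mem_ordinaryCore`); conjunct 2 (`X`-side)
:= x9-p1-w2 g8's flipped twin `…_flip_eq_zero` at the TRANSPORTED cores `C′_j := (ordinaryCore (σ•v)).map transportH1` (`…H4ExactRepLeftProofs`, p676339; their
`A_{m,j+1}`-stability = `WeierstrassCurve.scalarMapH1_mem_map_transportH1_ordinaryCore`, p676113); the Poitou–Tate input is the tree
theorem `poitouTate_holds`.  With `annSatAtP_holds` (p674099) and `exactAtP_of_exactRep_of_annSat` (p673458) this gives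
`stub_exactAtP` (closer: LEAD g9).  Bookkeeping toward one stub of one crux; no summit statement is proved here; BSD is not proved by
any of this.
-/

set_option linter.dupNamespace false
set_option autoImplicit false

noncomputable section

open scoped Classical Pointwise ContRepresentation TensorProduct NumberField

open Function NumberField IsDedekindDomain Field
open Literature Literature.NumberTheory.EllipticCurves WeierstrassCurve
open Literature.NumberTheory.GaloisCohomology Literature.NumberTheory.GaloisCohomology.Howard2004
open Literature.NumberTheory.GaloisRepresentations Literature.NumberTheory.GaloisRepresentations.DiscreteGaloisModule
open Literature.NumberTheory.Automorphic
open Literature.NumberTheory.EllipticCurves.ZpExtension (EisensteinLevel)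
open Summit.BirchSwinnertonDyer.BirchSwinnertonDyer.Theorems


namespace Summit.BirchSwinnertonDyer.BirchSwinnertonDyer.Theorems.HeegnerMuPartH4AtS

set_option synthInstance.maxHeartbeats 80000 in
set_option maxHeartbeats 1600000 in
/-- **INPUT 2′a (EXACT-REP) at the places `v ∣ p` holds on the frames** (`Stmt.exactRepAtP`, threshold `m₇ := 0`): at every
`(k, v ∈ S, p ∈ v)`, (`Y`-side) a compatible family `η` of the twisted local tower pairing to zero at level `k` with every saturated
strict-ordinary family is `p^{k+1} y″ +` (a family orthogonal to them at EVERY level) for a compatible `y″`, and (`X`-side) the flipped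
twin for the transported strict ordinary cores — x9-p1-w2 g8's kernel theorems
`eisensteinTower_exists_sub_pow_smul_forall_localCup[_flip]_eq_zero` at `C := ordinaryCore v` / `C′ := (ordinaryCore (σ•v)).map transportH1`,
Poitou–Tate by `poitouTate_holds`. [cite: Howard2004HeegnerKolyvagin, §1.3 H.4, Lemma 3.1.1 and Def. 3.2.6 (arXiv p. 7 L78–82, p. 15–16)]
[cite: MilneADT2006, Ch. I Cor. 2.3 and Thm. 2.6] -/
theorem exactRepAtP_holds : Stmt.exactRepAtP := by
  intro N _ W _ K _ _ p _ κ γ hyp _hirr _hirrK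
  haveI := hyp.isElliptic
  intro S _hpS _hbad _hSN _hSσ
  refine ⟨0, fun m hm _ L hL hLS c₀ σ hσ₁ hσ hτl hτ₂ D e log hc₀ hτ hDe he_red h4' h5' h6' h7' h8' h9' k v hvS hpv ↦ ?_⟩
  letI := IwasawaAlgebra.isDomain_quotient_X_pow_add_C p hm
  letI := IwasawaAlgebra.isDiscreteValuationRing_quotient_X_pow_add_C p hm
  haveI := IwasawaAlgebra.EisensteinCoeff.isLocalRing_succ p hm
  letI := IwasawaAlgebra.EisensteinCoeff.algebraOfSpecSucc p m
  haveI := W.isScalarTower_algebraOfSpecSucc (K := K) (p := p) (m := m)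
  letI := W.residueModuleSucc (K := K) (p := p) hm
  have hPT : poitouTate_selmerStructure_duality K := poitouTate_holds K
  refine ⟨fun η hη hη0 ↦ ?_, fun ξ hξ hξ0 ↦ ?_⟩
  · exact W.eisensteinTower_exists_sub_pow_smul_forall_localCup_eq_zero (κ.unitTwist (-1)) hm
      (ConjugationDatum.ofLifts σ hσ₁ hσ _ hτl hτ₂) D he_red hPT v
      (fun j ↦ ((W.baseChange K).ordinaryFiltrationAt v (fun j ↦ (W.baseChange K).torsionGaloisModuleReduce p j)
        (fun _ _ ↦ rfl)).ordinaryCore hm (j + 1))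
      (fun j c x hx ↦ ((W.baseChange K).ordinaryFiltrationAt v (fun j ↦ (W.baseChange K).torsionGaloisModuleReduce p j)
        (fun _ _ ↦ rfl)).scalarMapH1_mem_ordinaryCore hm (j + 1) c hx) k hη hη0
  · exact W.eisensteinTower_exists_sub_pow_smul_forall_localCup_flip_eq_zero (κ.unitTwist (-1)) hm
      (ConjugationDatum.ofLifts σ hσ₁ hσ _ hτl hτ₂) D he_red hPT v
      (fun j ↦ (((W.baseChange K).ordinaryFiltrationAt ((ConjugationDatum.ofLifts σ hσ₁ hσ _ hτl hτ₂).σ • v)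
        (fun j ↦ (W.baseChange K).torsionGaloisModuleReduce p j) (fun _ _ ↦ rfl)).ordinaryCore hm (j + 1)).map
        ((ConjugationDatum.ofLifts σ hσ₁ hσ _ hτl hτ₂).transportH1
          ((κ.unitTwist (-1)).eisensteinTwist ((W.baseChange K).torsionGaloisModule ((p : ℤ) ^ (j + 1))) hm (j + 1)) v))
      (fun j c y hy ↦ W.scalarMapH1_mem_map_transportH1_ordinaryCore (κ.unitTwist (-1)) hm
        (ConjugationDatum.ofLifts σ hσ₁ hσ _ hτl hτ₂) v
        ((W.baseChange K).ordinaryFiltrationAt ((ConjugationDatum.ofLifts σ hσ₁ hσ _ hτl hτ₂).σ • v)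
          (fun j ↦ (W.baseChange K).torsionGaloisModuleReduce p j) (fun _ _ ↦ rfl)) j c y hy) k hξ hξ0

end Summit.BirchSwinnertonDyer.BirchSwinnertonDyer.Theorems.HeegnerMuPartH4AtS

end
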